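import Summits.QuantumFields.BalabanUV.T4Continuum.Support.VariationalAdditive
import Summits.QuantumFields.BalabanUV.T4Continuum.Support.BalabanHardMinimizer
import Literature.Analysis.Complex.LoewnerMatrixCalculus

/-!
# T⁴ programme, spine node NE2 (U1a), lane P2 — LEAF D (+ KER) OF THE VARIATIONAL ROUTE, ABSTRACT PART: THE HERMITIAN EFFECTIVE
# OPERATOR of a constrained quadratic minimisation and the OPERATOR-NORM END of the additive canonical-pair bracket
# (`t4/skeletons/NE2-t4-ne2-p2.md` v0.6 §2.C leaf D / §7 supplier cut s1; cell `pub-balaban`, NE2 formalisation swarm, unit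
# `b2b-balaban-t4-ne2-formalise-leaf-02` gen 3, supplier to the row-NE2 co-owner lineage t4-ne2-p2; carriers in the companion
# `Support/VariationalCovariantEffective`)

HONEST FRAMING (T4-DAG p. 1).  Rung (B)+1 only — NOT infinite volume, NOT a mass gap, NOT Clay.  Node NE2 is NOT IN PRINT and NOT
proved here.  Everything below is finite-dimensional linear algebra ([folklore]) about arbitrary complex matrices `K`, `Q` — no Bałaban
object occurs; nothing printed is a hypothesis; no `def … : Prop` fact; no `sorry`; axioms standard.
HONEST DEPENDENCY (cell, verbatim): continuum YM on T⁴ ⇐ BetaPertH ∧ nine spine estimates (0/9 proved); BetaPertH ⇐ (D1) ∧ (D4) ∧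
CAP+tail; G-an2-4 gates asym, D1 and NE2/3/4.

WHY THIS FILE.  The variational route's assembly `VariationalCovariantAssembly.pair_bracket` (p211487) delivers, from the leaf shapes
UB⁺ / P⁺ / FED⁺ / ONE⁺ / REG⁺, the two one-sided ADDITIVE brackets between the block-spin VALUES `Δ_k(μ) = T_{Q_k} Sc (μ)` and
`Δ_{k+1}(μ) = T_{Q_k∘Q₁} Sf (μ)` (`VariationalTransfer.blockSpin`).  Row NE2's consumer currency is the OPERATOR NORM of the increments of
Hermitian matrices `X_k` (`CovariantAveragingTower.OneStepAveragedLaw (fun _ ↦ 1) 1 X e`), and the adapter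
`VariationalAdditive.oneStepAveragedLaw_of_forms` needs `re μ†X_kμ = Δ_k(μ)` with `X_k` HERMITIAN — the skeleton's leaf D «KKT/duality:
under KER the minimiser `H_k = G_aQ_k†(Q_kG_aQ_k†)⁻¹` exists, `Q_kH_k = id`, `Δ′_k(μ) = re μ†((Q_kG_aQ_k†)⁻¹ − a)μ` (Hermitian form)».  The
tree holds the identity behind it in the abstract (`BalabanHardMinimizer.hard_square`, lineage P1) and for Bałaban's `Δ_a` at `U = 1`
(`BalabanHardMinimizer.form_Delta0_eq`); this file supplies the GENERAL constrained-minimum reading and its instances on lane P2's carriers.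

CONTENTS.
* §1 (abstract; `K : Matrix ι ι ℂ` positive semidefinite, `Q : Matrix κ ι ℂ` with `Q.mulVec` surjective, KER «`re A†KA = 0 ∧ QA = 0 ⇒
  A = 0`», which follows from ANY coercivity inequality of leaf P⁺'s shape, `ker_of_coercive`): `Ka K Q a := K + a•QᴴQ` is positive
  definite (`Ka_posDef`), `Ca := Q·Ka⁻¹·Qᴴ` is positive definite (`Ca_posDef`), **`effOp K Q a := Ca⁻¹ − a•1`** is Hermitian
  (`effOp_isHermitian`), the hard minimiser **`hardMin K Q a μ := Ka⁻¹QᴴCa⁻¹μ`** lies in the fibre (`mulVec_hardMin_eq`) and minimises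
  (`qform_hardMin_le`), the exact split `re A†KA = re μ†(effOp)μ + re (A − A_*)†Ka(A − A_*)` (`qform_eq_effOp_add`; `qform` = the tree's `Literature.Analysis.Complex.qform`), and
  **`blockSpin_eq_effOp : blockSpin Q.mulVec (qform K) μ = re μ†(effOp K Q a)μ`**; consequences `effOp_form_nonneg`, `effOp_posSemidef`,
  and `effOp` is independent of the auxiliary `a > 0` (`effOp_eq_effOp`).
* §2 (the op-norm END, abstract): two such data over the SAME unit index whose block-spin values satisfy the two one-sided additive
  brackets with defects `e·Σ|μ_z|²`, `e′·Σ|μ_z|²` — exactly the CONCLUSION shape of `pair_bracket` (with `Q_k ∘ Q₁ = (Q₀·P).mulVec`,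
  `mulVec_comp_eq`) — give **`opNorm_effOp_sub_le_of_bracket : ‖X₁ − X₀‖ ≤ max e e′`**, and along a tower
  **`oneStepAveragedLaw_effOp : OneStepAveragedLaw (fun _ ↦ 1) 1 (k ↦ effOp (K k) (Q k) a) (k ↦ max (e k) (e′ k))`** — row NE2's wall
  SHAPE for a block-spin species MODULO the per-level brackets (which stay the leaves' business: UB⁺, ONE⁺, REG⁺ are NOT touched here).
* The instantiation on lane P2's carriers (charged scalar: transported block average `Q_T`, covariant Laplacian `Σ_μ D_μᴴD_μ`,
  the canonical pair `Q_T ∘ Q_{T′}`) is the companion module `Support/VariationalCovariantEffective`.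
-/

noncomputable section

open scoped Matrix ComplexConjugate ComplexOrder Matrix.Norms.L2Operator BigOperators

namespace Summit.QuantumFields.BalabanUV.T4Continuum.VariationalEffectiveOperator

open Summit.QuantumFields.BalabanUV.T4Continuum.VariationalTransfer (blockSpin blockSpin_le le_blockSpin blockSpin_eq_of_isMin
  blockSpin_nonneg')
open Summit.QuantumFields.BalabanUV.T4Continuum.VariationalAdditive (opNorm_sub_le_of_form_abs oneStepAveragedLaw_of_forms)
open Summit.QuantumFields.BalabanUV.T4Continuum.CovariantAveragingTower (OneStepAveragedLaw)
open Summit.QuantumFields.BalabanUV.T4Continuum.BalabanHardMinimizer (hard_square mulVec_hardMin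
  star_dotProduct_mulVec_of_hermitian star_conjTranspose_mulVec_dotProduct)
open Summit.QuantumFields.BalabanUV.T4Continuum.BalabanAveragedCoerciveFibre (star_dotProduct_conjTranspose_mulVec)
open Literature.MathematicalPhysics.QuantumFieldTheory.Balaban1983to89.B5Prop11Lower (nsq nsq_nonneg star_dotProduct_self)
open Literature.Analysis.Complex (qform qform_add qform_smul qform_nonneg_of_posSemidef)

/-! ## §1 The Hermitian effective operator of a constrained quadratic minimisation (abstract) -/

section Abstract

variable {ι κ : Type*} [Fintype ι] [Fintype κ] [DecidableEq ι] [DecidableEq κ]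

/-! The quadratic "action" `A ↦ re (A† K A)` of a matrix `K` is the tree's `Literature.Analysis.Complex.qform K A`
(`LoewnerDefs`), reused here with its `qform_smul` / `qform_nonneg_of_posSemidef`. -/

/-- the regularised operator `K_a := K + a • QᴴQ` (positive definite under KER, for `a > 0`). [folklore] -/
def Ka (K : Matrix ι ι ℂ) (Q : Matrix κ ι ℂ) (a : ℝ) : Matrix ι ι ℂ := K + (a : ℂ) • (Qᴴ * Q)

/-- the averaged resolvent `C_a := Q · K_a⁻¹ · Qᴴ` on the coarse index. [folklore] -/
def Ca (K : Matrix ι ι ℂ) (Q : Matrix κ ι ℂ) (a : ℝ) : Matrix κ κ ℂ := Q * (Ka K Q a)⁻¹ * Qᴴ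

/-- **THE EFFECTIVE OPERATOR** `X := C_a⁻¹ − a • 1 = (Q (K + aQᴴQ)⁻¹ Qᴴ)⁻¹ − a` of the constrained minimisation
`min {re A†KA : QA = μ} = re μ†Xμ` (skeleton leaf D; printed CONTEXT only: [Balaban1984PropagatorsI] (1.65)/(1.71), King CMP 102
(2.13)–(2.14) — not hypotheses). [folklore] -/
def effOp (K : Matrix ι ι ℂ) (Q : Matrix κ ι ℂ) (a : ℝ) : Matrix κ κ ℂ := (Ca K Q a)⁻¹ - (a : ℂ) • (1 : Matrix κ κ ℂ)

/-- **THE HARD MINIMISER** `A_* := K_a⁻¹ Qᴴ C_a⁻¹ μ` («`H = GQ*(QGQ*)⁻¹`» shape). [folklore] -/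
def hardMin (K : Matrix ι ι ℂ) (Q : Matrix κ ι ℂ) (a : ℝ) (μ : κ → ℂ) : ι → ℂ :=
  (Ka K Q a)⁻¹ *ᵥ (Qᴴ *ᵥ ((Ca K Q a)⁻¹ *ᵥ μ))

omit [DecidableEq ι] [DecidableEq κ] in
/-- `A† (K + a QᴴQ) A = A†KA + a · (QA)†(QA)`. [folklore] -/
theorem form_Ka (K : Matrix ι ι ℂ) (Q : Matrix κ ι ℂ) (a : ℝ) (A : ι → ℂ) :
    star A ⬝ᵥ (Ka K Q a *ᵥ A) = star A ⬝ᵥ (K *ᵥ A) + (a : ℂ) * (star (Q *ᵥ A) ⬝ᵥ (Q *ᵥ A)) := by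
  rw [Ka, Matrix.add_mulVec, Matrix.smul_mulVec, dotProduct_add, dotProduct_smul, ← Matrix.mulVec_mulVec,
    star_dotProduct_conjTranspose_mulVec, smul_eq_mul]

omit [DecidableEq ι] [DecidableEq κ] in
/-- real parts: `re A†K_aA = re A†KA + a·Σ|(QA)_z|²`. [folklore] -/
theorem qform_Ka (K : Matrix ι ι ℂ) (Q : Matrix κ ι ℂ) (a : ℝ) (A : ι → ℂ) :
    qform (Ka K Q a) A = qform K A + a * nsq (Q *ᵥ A) := by
  rw [qform, form_Ka, star_dotProduct_self, Complex.add_re, qform]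
  norm_cast

omit [Fintype ι] [DecidableEq ι] [DecidableEq κ] in
/-- a vector of vanishing `ℓ²`-mass vanishes. [folklore] -/
theorem eq_zero_of_nsq_le_zero {v : κ → ℂ} (h : nsq v ≤ 0) : v = 0 := by
  have h0 : nsq v = 0 := le_antisymm h (nsq_nonneg v)
  unfold nsq at h0
  rw [Finset.sum_eq_zero_iff_of_nonneg (fun i _ => by positivity)] at h0
  funext i
  have := h0 i (Finset.mem_univ i)
  rwa [sq_eq_zero_iff, norm_eq_zero] at this

omit [DecidableEq ι] [DecidableEq κ] in
/-- **KER FROM COERCIVITY**: any inequality of leaf P⁺'s shape `Σ|A_i|² ≤ C₁·Σ|(QA)_z|² + C₂·re A†KA` forces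
`re A†KA = 0 ∧ QA = 0 ⇒ A = 0`. [folklore] -/
theorem ker_of_coercive {K : Matrix ι ι ℂ} {Q : Matrix κ ι ℂ} {C₁ C₂ : ℝ}
    (hcoer : ∀ A, nsq A ≤ C₁ * nsq (Q *ᵥ A) + C₂ * qform K A) :
    ∀ A, qform K A = 0 → Q *ᵥ A = 0 → A = 0 := by
  intro A hA hQ
  refine eq_zero_of_nsq_le_zero ?_
  have h := hcoer A
  rw [hA, hQ] at h
  simpa [nsq] using h

variable {K : Matrix ι ι ℂ} {Q : Matrix κ ι ℂ} {a : ℝ}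

omit [Fintype ι] [DecidableEq ι] [DecidableEq κ] in
/-- `K_a` is Hermitian. [folklore] -/
theorem Ka_isHermitian (hK : K.PosSemidef) (Q : Matrix κ ι ℂ) (a : ℝ) : (Ka K Q a).IsHermitian :=
  hK.1.add ((Matrix.isHermitian_conjTranspose_mul_self Q).smul (by
    rw [IsSelfAdjoint, Complex.star_def, Complex.conj_ofReal]))

omit [DecidableEq ι] [DecidableEq κ] in
/-- **`K_a` IS POSITIVE DEFINITE** under KER (for `a > 0`). [folklore] -/
theorem Ka_posDef (hK : K.PosSemidef) (hker : ∀ A, qform K A = 0 → Q *ᵥ A = 0 → A = 0) (ha : 0 < a) :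
    (Ka K Q a).PosDef := by
  refine Matrix.PosDef.of_dotProduct_mulVec_pos (Ka_isHermitian hK Q a) fun A hA => ?_
  have h1 : 0 ≤ star A ⬝ᵥ (K *ᵥ A) := hK.dotProduct_mulVec_nonneg A
  have h2 : 0 ≤ star (Q *ᵥ A) ⬝ᵥ (Q *ᵥ A) := dotProduct_star_self_nonneg _
  have ha' : (0 : ℂ) ≤ (a : ℂ) := Complex.zero_le_real.mpr ha.le
  have hnn : 0 ≤ star A ⬝ᵥ (Ka K Q a *ᵥ A) := by
    rw [form_Ka]; exact add_nonneg h1 (mul_nonneg ha' h2)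
  refine lt_of_le_of_ne hnn fun h0 => hA ?_
  -- the real parts of both (nonnegative) summands vanish
  have hre : qform K A + a * nsq (Q *ᵥ A) = 0 := by
    rw [← qform_Ka]; unfold qform; rw [← h0]; simp
  have hq0 : 0 ≤ qform K A := qform_nonneg_of_posSemidef hK A
  have hn0 : 0 ≤ nsq (Q *ᵥ A) := nsq_nonneg _
  have hQ : Q *ᵥ A = 0 := eq_zero_of_nsq_le_zero (by nlinarith)
  have hf : qform K A = 0 := by nlinarith
  exact hker A hf hQ

omit [DecidableEq κ] in
/-- `K_a · K_a⁻¹ = 1`. [folklore] -/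
theorem Ka_mul_inv (hK : K.PosSemidef) (hker : ∀ A, qform K A = 0 → Q *ᵥ A = 0 → A = 0) (ha : 0 < a) :
    Ka K Q a * (Ka K Q a)⁻¹ = 1 :=
  Matrix.mul_nonsing_inv _ ((Matrix.isUnit_iff_isUnit_det _).mp (Ka_posDef hK hker ha).isUnit)

omit [Fintype κ] [DecidableEq ι] [DecidableEq κ] in
/-- a SURJECTIVE `Q` has injective `Qᴴ` (equivalently: injective `vecMul`). [folklore] -/
theorem vecMul_injective_of_surjective [Fintype κ] (hQ : Function.Surjective Q.mulVec) :
    Function.Injective Q.vecMul := by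
  intro v w h
  have h' : v ᵥ* Q = w ᵥ* Q := h
  rw [← sub_eq_zero]
  have hvw : (v - w) ᵥ* Q = 0 := by rw [Matrix.sub_vecMul, h', sub_self]
  obtain ⟨A, hA⟩ := hQ (star (v - w))
  have h1 : (v - w) ⬝ᵥ (Q *ᵥ A) = 0 := by rw [Matrix.dotProduct_mulVec, hvw, zero_dotProduct]
  rw [hA, dotProduct_self_star_eq_zero] at h1
  exact h1

omit [DecidableEq κ] in
/-- **`C_a = Q K_a⁻¹ Qᴴ` IS POSITIVE DEFINITE** (for `Q` surjective). [folklore] -/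
theorem Ca_posDef (hK : K.PosSemidef) (hQ : Function.Surjective Q.mulVec)
    (hker : ∀ A, qform K A = 0 → Q *ᵥ A = 0 → A = 0) (ha : 0 < a) : (Ca K Q a).PosDef :=
  (Ka_posDef hK hker ha).inv.mul_mul_conjTranspose_same (vecMul_injective_of_surjective hQ)

/-- `C_a · C_a⁻¹ = 1`. [folklore] -/
theorem Ca_mul_inv (hK : K.PosSemidef) (hQ : Function.Surjective Q.mulVec)
    (hker : ∀ A, qform K A = 0 → Q *ᵥ A = 0 → A = 0) (ha : 0 < a) : Ca K Q a * (Ca K Q a)⁻¹ = 1 :=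
  Matrix.mul_nonsing_inv _ ((Matrix.isUnit_iff_isUnit_det _).mp (Ca_posDef hK hQ hker ha).isUnit)

/-- **THE EFFECTIVE OPERATOR IS HERMITIAN**. [folklore] -/
theorem effOp_isHermitian (hK : K.PosSemidef) (hQ : Function.Surjective Q.mulVec)
    (hker : ∀ A, qform K A = 0 → Q *ᵥ A = 0 → A = 0) (ha : 0 < a) : (effOp K Q a).IsHermitian :=
  (Ca_posDef hK hQ hker ha).inv.isHermitian.sub (Matrix.isHermitian_one.smul (by
    rw [IsSelfAdjoint, Complex.star_def, Complex.conj_ofReal]))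

/-- the hard minimiser lies in the fibre: `Q A_* = μ`. [folklore] -/
theorem mulVec_hardMin_eq (hK : K.PosSemidef) (hQ : Function.Surjective Q.mulVec)
    (hker : ∀ A, qform K A = 0 → Q *ᵥ A = 0 → A = 0) (ha : 0 < a) (μ : κ → ℂ) :
    Q *ᵥ hardMin K Q a μ = μ :=
  mulVec_hardMin (G := (Ka K Q a)⁻¹) (by simpa [Ca, Matrix.mul_assoc] using Ca_mul_inv hK hQ hker ha) μ

/-- the form of the effective operator: `μ†Xμ = μ†C_a⁻¹μ − a·μ†μ`. [folklore] -/
theorem form_effOp (K : Matrix ι ι ℂ) (Q : Matrix κ ι ℂ) (a : ℝ) (μ : κ → ℂ) :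
    star μ ⬝ᵥ (effOp K Q a *ᵥ μ) = star μ ⬝ᵥ ((Ca K Q a)⁻¹ *ᵥ μ) - (a : ℂ) * (star μ ⬝ᵥ μ) := by
  rw [effOp, Matrix.sub_mulVec, Matrix.smul_mulVec, Matrix.one_mulVec, dotProduct_sub, dotProduct_smul, smul_eq_mul]

/-- **THE EXACT SPLIT** (hard completing-the-square for `K_a`, read back for `K`): for `QA = μ`,
`re A†KA = re μ†Xμ + re (A − A_*)† K_a (A − A_*)`. [folklore] -/
theorem qform_eq_effOp_add (hK : K.PosSemidef) (hQ : Function.Surjective Q.mulVec)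
    (hker : ∀ A, qform K A = 0 → Q *ᵥ A = 0 → A = 0) (ha : 0 < a) (A : ι → ℂ) (μ : κ → ℂ) (hA : Q *ᵥ A = μ) :
    qform K A = (star μ ⬝ᵥ (effOp K Q a *ᵥ μ)).re + qform (Ka K Q a) (A - hardMin K Q a μ) := by
  have hsq := hard_square (K := Ka K Q a) (G := (Ka K Q a)⁻¹) (Q := Q) (ci := (Ca K Q a)⁻¹)
    (Ka_isHermitian hK Q a).eq (Ka_mul_inv hK hker ha)
    (by simpa [Ca, Matrix.mul_assoc] using Ca_mul_inv hK hQ hker ha)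
    (Ca_posDef hK hQ hker ha).inv.isHermitian.eq A μ hA
  -- `A†K_aA = A†KA + a μ†μ`
  have hKa : star A ⬝ᵥ (Ka K Q a *ᵥ A) = star A ⬝ᵥ (K *ᵥ A) + (a : ℂ) * (star μ ⬝ᵥ μ) := by rw [form_Ka, hA]
  have key : star A ⬝ᵥ (K *ᵥ A)
      = star μ ⬝ᵥ (effOp K Q a *ᵥ μ) + star (A - hardMin K Q a μ) ⬝ᵥ (Ka K Q a *ᵥ (A - hardMin K Q a μ)) := by
    rw [form_effOp]
    have : star A ⬝ᵥ (K *ᵥ A) = star A ⬝ᵥ (Ka K Q a *ᵥ A) - (a : ℂ) * (star μ ⬝ᵥ μ) := by rw [hKa]; ring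
    rw [this, hsq, hardMin]
    ring
  rw [qform, key, Complex.add_re, qform]

/-- **THE HARD MINIMISER MINIMISES**: `re A_*†KA_* = re μ†Xμ ≤ re A†KA` on the fibre `QA = μ`. [folklore] -/
theorem qform_hardMin_eq (hK : K.PosSemidef) (hQ : Function.Surjective Q.mulVec)
    (hker : ∀ A, qform K A = 0 → Q *ᵥ A = 0 → A = 0) (ha : 0 < a) (μ : κ → ℂ) :
    qform K (hardMin K Q a μ) = (star μ ⬝ᵥ (effOp K Q a *ᵥ μ)).re := by
  rw [qform_eq_effOp_add hK hQ hker ha _ μ (mulVec_hardMin_eq hK hQ hker ha μ), sub_self]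
  simp [qform]

/-- the minimising inequality on the fibre. [folklore] -/
theorem qform_hardMin_le (hK : K.PosSemidef) (hQ : Function.Surjective Q.mulVec)
    (hker : ∀ A, qform K A = 0 → Q *ᵥ A = 0 → A = 0) (ha : 0 < a) {A : ι → ℂ} {μ : κ → ℂ} (hA : Q *ᵥ A = μ) :
    qform K (hardMin K Q a μ) ≤ qform K A := by
  rw [qform_hardMin_eq hK hQ hker ha, qform_eq_effOp_add hK hQ hker ha A μ hA]
  exact le_add_of_nonneg_right (qform_nonneg_of_posSemidef (Ka_posDef hK hker ha).posSemidef _)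

/-- **LEAF D — THE BLOCK-SPIN VALUE IS THE HERMITIAN FORM OF THE EFFECTIVE OPERATOR**:
`T_Q (re ·†K·) (μ) = min {re A†KA : QA = μ} = re μ† (effOp K Q a) μ`. [folklore] -/
theorem blockSpin_eq_effOp (hK : K.PosSemidef) (hQ : Function.Surjective Q.mulVec)
    (hker : ∀ A, qform K A = 0 → Q *ᵥ A = 0 → A = 0) (ha : 0 < a) (μ : κ → ℂ) :
    blockSpin Q.mulVec (qform K) μ = (star μ ⬝ᵥ (effOp K Q a *ᵥ μ)).re := by
  rw [← qform_hardMin_eq hK hQ hker ha μ]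
  exact blockSpin_eq_of_isMin (qform_nonneg_of_posSemidef hK) (mulVec_hardMin_eq hK hQ hker ha μ)
    (fun A hA => qform_hardMin_le hK hQ hker ha hA)

/-- the form of the effective operator is nonnegative. [folklore] -/
theorem effOp_form_nonneg (hK : K.PosSemidef) (hQ : Function.Surjective Q.mulVec)
    (hker : ∀ A, qform K A = 0 → Q *ᵥ A = 0 → A = 0) (ha : 0 < a) (μ : κ → ℂ) :
    0 ≤ (star μ ⬝ᵥ (effOp K Q a *ᵥ μ)).re := by
  rw [← blockSpin_eq_effOp hK hQ hker ha μ]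
  exact blockSpin_nonneg' (qform_nonneg_of_posSemidef hK)

/-- **THE EFFECTIVE OPERATOR IS POSITIVE SEMIDEFINITE**. [folklore] -/
theorem effOp_posSemidef (hK : K.PosSemidef) (hQ : Function.Surjective Q.mulVec)
    (hker : ∀ A, qform K A = 0 → Q *ᵥ A = 0 → A = 0) (ha : 0 < a) : (effOp K Q a).PosSemidef := by
  refine Matrix.PosSemidef.of_dotProduct_mulVec_nonneg (effOp_isHermitian hK hQ hker ha) fun μ => ?_
  have him : (star μ ⬝ᵥ (effOp K Q a *ᵥ μ)).im = 0 := by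
    simpa using (effOp_isHermitian hK hQ hker ha).im_star_dotProduct_mulVec_self μ
  rw [Complex.le_def]
  exact ⟨by simpa using effOp_form_nonneg hK hQ hker ha μ, by simpa using him.symm⟩

omit [Fintype ι] [DecidableEq ι] in
/-- Hermitian matrices with the same real quadratic form are equal. [folklore] -/
theorem eq_of_forms_eq {X Y : Matrix κ κ ℂ} (hX : X.IsHermitian) (hY : Y.IsHermitian)
    (h : ∀ μ : κ → ℂ, (star μ ⬝ᵥ (X *ᵥ μ)).re = (star μ ⬝ᵥ (Y *ᵥ μ)).re) : X = Y := by
  have h0 : ‖X - Y‖ ≤ 0 :=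
    opNorm_sub_le_of_form_abs hY hX le_rfl (fun v => by rw [h v]; simp) (fun v => by rw [h v]; simp)
  exact sub_eq_zero.mp (norm_le_zero_iff.mp h0)

/-- the effective operator does NOT depend on the auxiliary `a > 0`. [folklore] -/
theorem effOp_eq_effOp (hK : K.PosSemidef) (hQ : Function.Surjective Q.mulVec)
    (hker : ∀ A, qform K A = 0 → Q *ᵥ A = 0 → A = 0) (ha : 0 < a) {b : ℝ} (hb : 0 < b) :
    effOp K Q a = effOp K Q b :=
  eq_of_forms_eq (effOp_isHermitian hK hQ hker ha) (effOp_isHermitian hK hQ hker hb) fun μ => by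
    rw [← blockSpin_eq_effOp hK hQ hker ha, ← blockSpin_eq_effOp hK hQ hker hb]

end Abstract

/-! ## §2 The operator-norm END of the additive bracket (abstract) -/

section OpNorm

variable {ι₀ ι₁ κ : Type*} [Fintype ι₀] [Fintype ι₁] [Fintype κ] [DecidableEq ι₀] [DecidableEq ι₁] [DecidableEq κ]

omit [Fintype κ] [DecidableEq ι₀] [DecidableEq ι₁] [DecidableEq κ] in
/-- composite averagings: `(Q₀ · P).mulVec = Q₀.mulVec ∘ P.mulVec` (so `blockSpin (Q₀ · P).mulVec = blockSpin (Q₀.mulVec ∘ P.mulVec)`,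
the `Q_k ∘ Q₁` of `pair_bracket`). [folklore] -/
theorem mulVec_comp_eq [Fintype κ] (Q₀ : Matrix κ ι₀ ℂ) (P : Matrix ι₀ ι₁ ℂ) :
    (Q₀ * P).mulVec = Q₀.mulVec ∘ P.mulVec := by
  funext f; simp [Matrix.mulVec_mulVec]

/-- **THE OP-NORM END**: two constrained quadratic minimisations `(K₀, Q₀)`, `(K₁, Q₁)` over the same unit index whose block-spin values
satisfy the two one-sided additive brackets (`pair_bracket`'s conclusion shape, `qZ = nsq`) have effective operators at distance
`‖X₁ − X₀‖ ≤ max e e′` in operator norm. [folklore] -/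
theorem opNorm_effOp_sub_le_of_bracket {K₀ : Matrix ι₀ ι₀ ℂ} {Q₀ : Matrix κ ι₀ ℂ} {K₁ : Matrix ι₁ ι₁ ℂ} {Q₁ : Matrix κ ι₁ ℂ}
    (hK₀ : K₀.PosSemidef) (hQ₀ : Function.Surjective Q₀.mulVec) (hker₀ : ∀ A, qform K₀ A = 0 → Q₀ *ᵥ A = 0 → A = 0)
    (hK₁ : K₁.PosSemidef) (hQ₁ : Function.Surjective Q₁.mulVec) (hker₁ : ∀ A, qform K₁ A = 0 → Q₁ *ᵥ A = 0 → A = 0)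
    {a : ℝ} (ha : 0 < a) {e e' : ℝ} (he : 0 ≤ e)
    (hbr : ∀ μ, blockSpin Q₀.mulVec (qform K₀) μ ≤ blockSpin Q₁.mulVec (qform K₁) μ + e * nsq μ ∧
      blockSpin Q₁.mulVec (qform K₁) μ ≤ blockSpin Q₀.mulVec (qform K₀) μ + e' * nsq μ) :
    ‖effOp K₁ Q₁ a - effOp K₀ Q₀ a‖ ≤ max e e' := by
  refine opNorm_sub_le_of_form_abs (effOp_isHermitian hK₀ hQ₀ hker₀ ha) (effOp_isHermitian hK₁ hQ₁ hker₁ ha)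
    (he.trans (le_max_left e e')) (fun μ => ?_) (fun μ => ?_)
  · rw [← blockSpin_eq_effOp hK₀ hQ₀ hker₀ ha, ← blockSpin_eq_effOp hK₁ hQ₁ hker₁ ha]
    have h := (hbr μ).2
    have hn : e' * nsq μ ≤ max e e' * ∑ i, ‖μ i‖ ^ 2 := mul_le_mul_of_nonneg_right (le_max_right e e') (nsq_nonneg μ)
    unfold nsq at h hn; linarith
  · rw [← blockSpin_eq_effOp hK₀ hQ₀ hker₀ ha, ← blockSpin_eq_effOp hK₁ hQ₁ hker₁ ha]
    have h := (hbr μ).1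
    have hn : e * nsq μ ≤ max e e' * ∑ i, ‖μ i‖ ^ 2 := mul_le_mul_of_nonneg_right (le_max_left e e') (nsq_nonneg μ)
    unfold nsq at h hn; linarith

end OpNorm

section Tower

variable {κ : Type*} [Fintype κ] [DecidableEq κ] {ι : ℕ → Type*} [∀ k, Fintype (ι k)] [∀ k, DecidableEq (ι k)]

/-- **ROW NE2's WALL SHAPE FOR A BLOCK-SPIN SPECIES, MODULO THE PER-LEVEL BRACKETS**: a tower of constrained quadratic minimisations
`(K_k, Q_k)` onto the fixed unit index `κ` whose consecutive block-spin values satisfy the additive brackets with defects `e_k`, `e′_k`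
has `OneStepAveragedLaw (fun _ ↦ 1) 1 (k ↦ effOp (K k) (Q k) a) (k ↦ max (e k) (e′ k))`. [folklore] -/
theorem oneStepAveragedLaw_effOp (K : ∀ k, Matrix (ι k) (ι k) ℂ) (Q : ∀ k, Matrix κ (ι k) ℂ)
    (hK : ∀ k, (K k).PosSemidef) (hQ : ∀ k, Function.Surjective (Q k).mulVec)
    (hker : ∀ k A, qform (K k) A = 0 → Q k *ᵥ A = 0 → A = 0) {a : ℝ} (ha : 0 < a) (e e' : ℕ → ℝ) (he : ∀ k, 0 ≤ e k)
    (hbr : ∀ k μ, blockSpin (Q k).mulVec (qform (K k)) μ ≤ blockSpin (Q (k + 1)).mulVec (qform (K (k + 1))) μ + e k * nsq μ ∧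
      blockSpin (Q (k + 1)).mulVec (qform (K (k + 1))) μ ≤ blockSpin (Q k).mulVec (qform (K k)) μ + e' k * nsq μ) :
    OneStepAveragedLaw (ι := fun _ => κ) (fun _ => (1 : Matrix κ κ ℂ)) 1 (fun k => effOp (K k) (Q k) a)
      (fun k => max (e k) (e' k)) := by
  refine oneStepAveragedLaw_of_forms _ (fun k => effOp_isHermitian (hK k) (hQ k) (hker k) ha) _
    (fun k => (he k).trans (le_max_left _ _)) (fun k μ => ?_) (fun k μ => ?_)
  · rw [← blockSpin_eq_effOp (hK k) (hQ k) (hker k) ha, ← blockSpin_eq_effOp (hK (k+1)) (hQ (k+1)) (hker (k+1)) ha]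
    have h := (hbr k μ).2
    have hn : e' k * nsq μ ≤ max (e k) (e' k) * ∑ i, ‖μ i‖ ^ 2 :=
      mul_le_mul_of_nonneg_right (le_max_right _ _) (nsq_nonneg μ)
    unfold nsq at h hn; linarith
  · rw [← blockSpin_eq_effOp (hK k) (hQ k) (hker k) ha, ← blockSpin_eq_effOp (hK (k+1)) (hQ (k+1)) (hker (k+1)) ha]
    have h := (hbr k μ).1
    have hn : e k * nsq μ ≤ max (e k) (e' k) * ∑ i, ‖μ i‖ ^ 2 :=
      mul_le_mul_of_nonneg_right (le_max_left _ _) (nsq_nonneg μ)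
    unfold nsq at h hn; linarith

end Tower

end Summit.QuantumFields.BalabanUV.T4Continuum.VariationalEffectiveOperator

end
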